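import Literature.Computability.Complexity.Algebrization
import Literature.Computability.Complexity.StructuralPH
import Literature.Computability.Complexity.CircuitClasses
import Literature.Barriers.PneNP.Relativization
import HarnessLib

/-!
# Barrier catalogue `PneNP`: algebrization (Aaronson–Wigderson 2008/2009)

D-0021 barrier entry for the summit `PneNP` (`∃ L ∈ NP, L ∉ P`).

**The printed results** (S. Aaronson, A. Wigderson, *Algebrization: a new barrier in complexity
theory*, STOC 2008 = ACM TOCT 1 (2009); locators of the 50-page full version, checked with
`lit read`):

* Def. 2.3 (algebrization): the inclusion `C ⊆ D` *algebrizes* if `C^A ⊆ D^Ã` for all oracles `A`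
  and all finite-field low-degree extensions `Ã` of `A`; "`C ⊆ D` does not algebrize, or proving
  `C ⊆ D` would require non-algebrizing techniques, if there exist `A, Ã` such that `C^A ⊄ D^Ã`".
  The separation `C ⊄ D` algebrizes if `C^Ã ⊄ D^A` for all `A, Ã`; it "does not algebrize, or
  proving `C ⊄ D` would require non-algebrizing techniques, if there exist `A, Ã` such that
  `C^Ã ⊆ D^A`" (p. 9).
* Thm. 5.1 (p. 23): "There exist `A, Ã` such that `NP^Ã ⊆ P^A`" (`A` PSPACE-complete, `Ã` its
  multilinear extension, PSPACE-computable by Babai–Fortnow–Lund; "any proof of `P ≠ NP` will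
  require non-algebrizing techniques").
* Thm. 5.3 (pp. 23–24): "There exist `A, Ã` such that `NP^A ⊄ P^Ã`" ("any proof of `P = NP` would
  require non-algebrizing techniques"; BGS diagonalization plus the algebraic query lower bound
  Lemma 4.5, `Ã` multiquadratic).
* §3 (Thms. 3.7, 3.8, 3.17, 3.18): `PSPACE^{A[poly]} ⊆ IP^Ã`, `NEXP^{A[poly]} ⊆ MIP^Ã`,
  `MA_EXP^Ã ⊄ P^A/poly`, `PromiseMA^Ã ⊄ SIZE^A(n^k)` — the known arithmetization-based
  non-relativizing results algebrize.
* Thm. 5.6 (p. 26): "There exist `A, Ã` such that `NTIME^Ã(2ⁿ) ⊂ SIZE^A(n)`" ("any proof of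
  `NEXP ⊄ P/poly` will require non-algebrizing techniques"; §1.2 p. 3 lists the consequence
  `NP^Ã ⊂ SIZE^A(n)`: "non-algebrizing techniques will be needed even ... to prove superlinear
  circuit lower bounds for NP"). Recorded below through the corollary `NP^Ã ⊆ SIZE^A(O(n))`
  (`Algebrization_npLinearSize`) over oracle circuits `SIZERel` (circuits over `B₂` plus
  `A`-oracle gates, defined here); `NEXP^Ã` itself is not in the tree.
* Thms. 5.7–5.8 (p. 27, stated after the padding remark "Theorem 5.6 immediately gives `A, Ã`
  such that `NEXP^Ã ⊂ P^A/poly`. This collapse is almost the best possible, since Theorem 3.17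
  implies that there do not exist `A, Ã` such that `MA_EXP^Ã ⊂ P^A/poly`. Wilson [43] gave an
  oracle `A` relative to which `EXP^{NP^A} ⊂ P^A/poly`. Using similar ideas, one can
  straightforwardly generalize the construction of Theorem 5.6 to obtain the following"):
  **Thm. 5.7**: "There exist `A, Ã` such that `EXP^{NP^Ã} ⊂ P^A/poly`." **Thm. 5.8**: "There
  exist `A, Ã` such that `BPEXP^Ã ⊂ P^A/poly`." "We omit the details of the above two
  constructions." Consequence as printed (Def. 2.3): circuit lower bounds `EXP^NP ⊄ P/poly`
  (a fortiori exponential lower bounds for `E^NP`, the class of Korten's range-avoidance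
  equivalence, FOCS 2021, Thm. 10) and `BPEXP ⊄ P/poly` require non-algebrizing techniques.
  Quoted only, NOT vendored as named facts: the proofs are omitted in print (the relativized
  `EXP^NP` case is Wilson 1985, Thm. 3.3, quoted in `RelativizedCircuitSize.lean`).
* Thm. 10.2 (p. 43): any proof of `P ≠ NP` requires techniques that are non-`k`-algebrizing for
  every constant `k`; §10.2 (Thm. 10.5): likewise for extensions over `k × k` matrix algebras,
  `k = poly(n)`.

**What this file adds.** The tree already has AW's notions `IsAlgebrizingInclusion`,
`IsAlgebrizingSeparation`, `ExtensionOracle`, `IsExtensionOf` (`Algebrization.lean`, prime fields,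
any multidegree bound) and the two oracle facts `Literature.Computability.Complexity.aaronson_wigderson_collapse` (Thm. 5.1) /
`aaronson_wigderson_separation` (Thm. 5.3) (`StructuralPH.lean`). Here: the barrier fact
`Algebrization` (both at once), PROVED from those facts (`Algebrization.of_aw`); the no-go
theorems in AW's own vocabulary, proved: `not_isAlgebrizingSeparation_NP_P` (no algebrizing proof
of `NP ⊄ P`, i.e. of `PneNP`), `not_isAlgebrizingInclusion_NP_P` (none of `NP ⊆ P`); and the
containment of the catalogue's relativization class `Relativizes` (language oracles,
`Literature/Barriers/PneNP/Relativization.lean`) in the algebrization class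
(`isAlgebrizingInclusion_of_relativizes`, `isAlgebrizingSeparation_of_relativizes`,
`Algebrization.not_relativizes`; Impagliazzo–Kabanets–Kolokolova 2009, §1: "all relativizing
techniques are contained in the [AW] algebrizing techniques"); and, for the circuit-lower-bound
strengthenings of `PneNP` (route shape
`NP ⊄ SIZE(O(n))` / `NP ⊄ P/poly`), the oracle-circuit classes `SIZERel A s` with the corollary
of Thm. 5.6 as the named fact `Algebrization_npLinearSize` (per-language linear constants,
`NP^Ã ⊆ ⋃ c, SIZE^A(c·n + c)`; oracle gates charged their fan-in, `oracleGateCost`) and its no-go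
reading `not_forall_not_NPRel_subset_SIZERel` (proved from the fact); adequacy `self_mem_SIZERel`
(`A ∈ SIZE^A(n+1)`). Barrier audit 2026-08-16 (last section): the NARROWED entry
`AlgebrizationNarrow` — the symmetric printed form (AW p. 9) as the Lean statement, with the
corrected `technique_class` (statement-level algebrizing + relativizing; arithmetization /
interactive proofs / PCPs as ingredients are not covered) and the published evasions on the
circuit-lower-bound line (algorithmic method); proved in `AlgebrizationSymmetric.lean`.

## Sources (locators verified with `lit read`)

* [AaronsonWigderson2008] full version: Def. 2.1–2.3 (pp. 8–9), §1.1–1.3 (pp. 2–6), §3, Thm. 5.1,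
  5.2, 5.3 (pp. 23–24), Thm. 5.6 (p. 26), Thms. 5.7–5.8 (p. 27), Thm. 5.11 (pp. 27–28), §5.4 end (p. 29: Drucker's
  `NP^A ⊄ PCP^Ã`), §9 (p. 42), Prop. 10.1 and Thm. 10.2 (pp. 42–43), §10.2 (pp. 43–45), §11
  (pp. 45–47). Journal version [AaronsonWigderson2009].
* [ImpagliazzoKabanetsKolokolova2009] §1 (pp. 2–3), §2 (Def. 2.1, Thm. 2.3, p. 4), Thm. 4.1 (3),
  Thm. 4.10, §5.
* [AydinliogluBach2018] (read in the ECCC TR16-040 version) §1 (closure under inference,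
  universality), §1.2 with Fig. 1, Summary of Results, §5 (open problems: the PCP theorem).
* [Aaronson2016PvsNP] §6.3.3 (Thms. 61–63), §6.4 ("ironic complexity theory ... bypasses the natural
  proofs, relativization, and algebrization barriers"), §6.4.2 (Thm. 66 `NEXP ⊄ ACC` and the
  algebraic oracle with `NEXP^Ã ⊂ ACC^Ã`).
* [AroraBarakCC2009] Ch. 23 notes (PDF p. 596: "[AW08] showed a new obstacle ... algebrization").
-/

namespace Literature.Barriers.PneNP

open _root_.Computability Literature.Computability.Complexity

/-! ### The barrier fact -/

/-- **Algebrization barrier for P versus NP (Aaronson–Wigderson, Thm. 5.1 and Thm. 5.3).**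
There are an oracle language `A` and a low-degree extension `Ã` of `A` with `NP^Ã ⊆ P^A`
(Thm. 5.1), and there are `A, Ã` with `NP^A ⊄ P^Ã` (Thm. 5.3). By AW Def. 2.3 the first says
that the separation `NP ⊄ P` (`P ≠ NP`) does not algebrize, the second that the inclusion
`NP ⊆ P` (`P = NP`) does not algebrize. Over the tree's extension oracles (prime fields, some
multidegree bound `d`): by definition the conjunction of the `StructuralPH.lean` facts
`Literature.PNP.aaronson_wigderson_collapse ∧ Literature.PNP.aaronson_wigderson_separation`
(`Algebrization.of_aw`, `algebrization_iff`).
Technique class as explicit definitions (D-0021 (e)): AW Def. 2.3 is the tree's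
`Literature.CplxCore.IsAlgebrizingInclusion C D` / `IsAlgebrizingSeparation C D`
(`Literature/Computability/Complexity/Algebrization.lean`); an algebrizing proof of `NP ⊄ P`
establishes `IsAlgebrizingSeparation NPRel PRel`, one of `NP ⊆ P` establishes
`IsAlgebrizingInclusion NPRel PRel`; both are refuted below.

BARRIER
technique_class: algebrizing, arithmetization, low-degree-extension, interactive-proofs, relativizing
blocks: algebrizing proofs (AW Def. 2.3) of `PneNP` read as the separation `NP ⊄ P` (`not_isAlgebrizingSeparation_NP_P`) and of its negation `NP ⊆ P` (`not_isAlgebrizingInclusion_NP_P`); in print also `RP ⊆ P`, `NP ⊆ BPP`, `NP ⊆ BQP` (Thms. 5.3–5.4, 5.11) and the strengthenings of `P ≠ NP` by circuit lower bounds — superlinear circuit lower bounds for `NP` (`NP ⊄ SIZE(O(n))`, hence `NP ⊄ SIZE(n^k)`, `NP ⊄ P/poly`; fact `Algebrization_npLinearSize`, no-go `not_forall_not_NPRel_subset_SIZERel`) and `NEXP ⊄ P/poly` (Thm. 5.6; `NEXP^Ã` not formalised in the tree) [cite: AaronsonWigderson2008, §1.2 p. 3, Thms. 5.1, 5.3,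 5.6].
because: every known non-relativizing result obtained by arithmetization algebrizes — `PSPACE^{A[poly]} ⊆ IP^Ã`, `NEXP^{A[poly]} ⊆ MIP^Ã`, `MA_EXP^Ã ⊄ P^A/poly`, `PromiseMA^Ã ⊄ SIZE^A(n^k)` (§3, Thms. 3.7, 3.8, 3.17, 3.18), the verifier simply querying `Ã` where the arithmetized formula contains oracle gates (§1.3.1) — whereas for `A` PSPACE-complete and `Ã` its multilinear extension (PSPACE-computable, Babai–Fortnow–Lund) `NP^Ã = P^A = PSPACE` (Thm. 5.1), and a Baker–Gill–Solovay diagonalization armed with the algebraic query lower bound (Lemma 4.5) gives `A, Ã` with `NP^A ⊄ P^Ã` (Thm. 5.3) [cite: AaronsonWigderson2008, §1.3, §3, Thm. 5.1, Thm. 5.3].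
evasions_known: none published for P vs NP; for P vs NP (and P vs PSPACE) AW list what does NOT suffice — `k`-fold arithmetization for any constant `k` (Thm. 10.2) and extensions over matrix algebras of subexponential dimension (§10.2, Thm. 10.5) — whereas for the circuit-lower-bound line (`NEXP` vs `P/poly`, Thm. 5.6 / `Algebrization_npLinearSize`, and `RP ⊆ P`) whether double-algebrizing techniques already suffice is stated OPEN [cite: AaronsonWigderson2008, §10.1 p. 43]; and what might: exploiting the structure (small formula origin) of arithmetized polynomials (§11 (2)), richer algebraic structures (§11 (1)); results argued to be non-relativizing without arithmetization (small-depth circuit lower bounds relative to oracle gates, "well covered by the natural proofs barrier"; Cook–Levin/PCP locality per Arora–Impagliazzo–Vazirani; `TIME(f) ≠ SPACE(f)`, `TIME(n) ≠ NTIME(n)`, time–space trade-offs for SAT) are outside the analysis: "about other non-relativizing techniques they are comparatively silent" [cite: AaronsonWigderson2008, §9 p. 42, Thm. 10.2, §10.2, §11]; the axiomatic variant `ACT` (arithmetic checkability) leaves P vs NP, P vs BPP and explicit circuit lower bounds independent as well [cite: ImpagliazzoKabanetsKolokolova2009, §1 (results (iii))]. AUDIT 2026-08-16 (see `AlgebrizationNarrow`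 below for the corrected block): on the circuit-lower-bound line listed under `blocks` a published evasion EXISTS — the algorithmic method ("ironic complexity": a better-than-brute-force satisfiability algorithm for the circuit class), Williams's `NEXP ⊄ ACC⁰` and Murray–Williams's `NQP ⊄ ACC⁰`, whose conclusions are non-algebrizing statements (an algebraic oracle `Ã` with `NEXP^Ã ⊂ ACC^Ã`; the proof "defeats all the known barriers (relativization, algebrization, and natural proofs)") [cite: Aaronson2016PvsNP, §6.4 and §6.4.2] [cite: Williams2014, Thm. 1.1] [cite: MurrayWilliams2018, Thm. 1.1]; and the PCP theorem, an arithmetization-based result, is itself non-algebrizing in AW's sense (Drucker: `A, Ã` with `NP^A ⊄ PCP^Ã`) [cite: AaronsonWigderson2008, §5.4 p. 29].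
scope_caveats: AW's notion is defined for inclusions and separations only, is asymmetric (only one side receives `Ã`), and is not known to be transitive or closed under modus ponens (AW §10.1: "We do not know ... and suspect that it is negative"), so "it is conceivable that several algebrizing premises could imply (in a relativizing way) a non-algebrizing conclusion" [cite: ImpagliazzoKabanetsKolokolova2009, §1 p. 2] [cite: AaronsonWigderson2008, §10.1]; the tree's `ExtensionOracle` ranges over prime fields `𝔽_p` only (AW Def. 2.2: all finite fields), which weakens `P^Ã`/`NP^Ã` and therefore preserves both Thm. 5.1 (an inclusion into `P^A`) and Thm. 5.3 (a separation from `P^Ã`) (`Algebrization.lean`, `StructuralPH.lean` design notes) [cite: AaronsonWigderson2008, Def. 2.2]. AUDIT 2026-08-16: (i) the `technique_class` tokens `arithmetization`, `low-degree-extension`, `interactive-proofs` are covered only in so far as the CONCLUSION of an argument is an algebrizing statement of AW Def. 2.3 — as INGREDIENTS of a proof containing one non-black-box step they are not blocked (the PCP theorem and unrestricted `MIP = NEXP` are arithmetization-based yet non-algebrizing; Williams's `NEXP ⊄ ACC⁰` uses the arithmetization-based collapse `EXP ⊆ P/poly ⇒ EXP = MA` and reaches a non-algebrizing conclusion), corrected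 block `AlgebrizationNarrow` [cite: AaronsonWigderson2008, §5.4 p. 29 and §10.1] [cite: ImpagliazzoKabanetsKolokolova2009, Thm. 4.1 (3) and §5] [cite: AydinliogluBach2018, §1] [cite: Aaronson2016PvsNP, §6.4.2]; (ii) prime fields: the two `∃`-facts are implied by print, but the induced no-go theorems are correspondingly WEAKER than print — they refute `IsAlgebrizingSeparation`/`IsAlgebrizingInclusion` over prime-field extension oracles, a technique that needs all finite fields is refuted by the printed Thms. 5.1/5.3 only; (iii) the symmetric forms (both sides receive `Ã`; AW p. 9 "even under our 'broader' notion") are blocked as well: `AlgebrizationNarrow`, proved in `AlgebrizationSymmetric.lean` [cite: AaronsonWigderson2008, Def. 2.3 discussion p. 9]. AUDIT 2026-08-17 (gen 1, of the discharge file `AlgebrizationProofs.lean`; the discharges `Algebrization_holds` / `Algebrization_npLinearSize_holds` are CONFIRMED, locators re-read: Def. 2.1–2.3 pp. 8–9, Thm. 5.6 pp. 26–27, §1.2 p. 3): (iv) fan-in locus of the circuit line under `blocks` — the collapse world of Thm. 5.6 decides each `NP^Ã` language with `O(n)` unary gates and ONE `A`-gate of fan-in `4n` (tree: `8n`, `AW56.exists_lookup_circuit`),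 and no pair `(A, Ã)` of any multidegree has `NP^Ã ⊆ ⋃ c, SIZE^A_{≤K}(c·n + c)` for a fan-in bound `K(n) ≤ (p/q)·n`, `p < q`, unless `NP ⊆ ⋃ c, SIZE(c·n^k + c)` for one fixed `k` (then `A ∈ P^A ⊆ NP^Ã` is narrowly self-reducible in linear size and unrolls into `SIZE(M·n^k + M)`, after which every `A`-gate is a polynomial gadget): arguments for superlinear `NP` bounds claimed robust only under `A`-gates of fan-in `≤ (1-δ)·n` meet no contrary world on this line (the absence of an obstruction, not a method; such "localizable" techniques are limited by `Locality.lean`, `GateEliminationLimit.lean`, natural proofs) — narrowed entry `Algebrization_npLinearSizeNarrow`, proved in `AlgebrizationProofsFanIn.lean`, which also sharpens rider (c) of `RelativizedCircuitSizeNarrow` (Wilson) from fan-in `O(log n)` to `(1-δ)·n` [cite: AaronsonWigderson2008, Thm. 5.6 (p. 26: "hardwire the string z'") and §1.2 p. 3] [cite: Wilson1985, Thm. 0 (p. 172) and Lemma 2 (p. 173)].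
status: theorem (established) [cite: AaronsonWigderson2008, Thm. 5.1, Thm. 5.3] -/
def Algebrization : Prop :=
  Literature.Computability.Complexity.aaronson_wigderson_collapse ∧ Literature.Computability.Complexity.aaronson_wigderson_separation

/-- `Algebrization` is, by definition, the conjunction of the tree facts
`aaronson_wigderson_collapse` (Thm. 5.1) and `aaronson_wigderson_separation` (Thm. 5.3) of
`StructuralPH.lean` (named, not copied, so that the barrier cannot drift from them).
[cite: AaronsonWigderson2008, Thm. 5.1, Thm. 5.3] -/
theorem Algebrization.of_aw (h₁ : Literature.Computability.Complexity.aaronson_wigderson_collapse)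
    (h₂ : Literature.Computability.Complexity.aaronson_wigderson_separation) : Algebrization :=
  ⟨h₁, h₂⟩

/-- Unfolding: the two oracle facts spelled out (`∃ A Ã d, Ã` extends `A` `∧ NP^Ã ⊆ P^A`, and
`∃ A Ã d, … ∧ NP^A ⊄ P^Ã`). [cite: AaronsonWigderson2008, Thm. 5.1, Thm. 5.3] -/
theorem algebrization_iff :
    Algebrization ↔
      (∃ (A : Language Bool) (Ã : ExtensionOracle) (d : ℕ), Ã.IsExtensionOf A d ∧
          NPRel Ã.toOracle ⊆ PRel (Oracle.ofLanguage A)) ∧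
        ∃ (A : Language Bool) (Ã : ExtensionOracle) (d : ℕ), Ã.IsExtensionOf A d ∧
          ¬ NPRel (Oracle.ofLanguage A) ⊆ PRel Ã.toOracle :=
  Iff.rfl

/-! ### The no-go theorems in Aaronson–Wigderson's vocabulary (proved) -/

/-- **"Any proof of `P ≠ NP` will require non-algebrizing techniques"** (AW §5.1, from Thm. 5.1
via Def. 2.3): the separation `NP ⊄ P` — the summit `PneNP` read as `¬ NP ⊆ P` over the
relativised classes, whose `O = ∅` instance is the summit's definiens by
`pneNP_shape_empty_iff_wave0` (`Relativization.lean`) — is not an algebrizing separation in the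
sense of `IsAlgebrizingSeparation`. [cite: AaronsonWigderson2008, Thm. 5.1 with Def. 2.3] -/
theorem Algebrization.not_isAlgebrizingSeparation_NP_P (h : Algebrization) :
    ¬ IsAlgebrizingSeparation NPRel PRel := by
  obtain ⟨⟨A, Ã, d, hÃ, hsub⟩, -⟩ := algebrization_iff.1 h
  exact fun halg => halg A Ã d hÃ hsub

/-- **"Any proof of `P = NP` would require non-algebrizing techniques"** (AW §5.1, from Thm. 5.3
via Def. 2.3): the inclusion `NP ⊆ P` is not an algebrizing inclusion in the sense of
`IsAlgebrizingInclusion` (the same one-line contrapositive as the tree's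
`Literature.Computability.Complexity.not_isAlgebrizingInclusion_of` in `AlgebrizationBarriers.lean`, not imported to keep
this file's imports minimal). [cite: AaronsonWigderson2008, Thm. 5.3 with Def. 2.3] -/
theorem Algebrization.not_isAlgebrizingInclusion_NP_P (h : Algebrization) :
    ¬ IsAlgebrizingInclusion NPRel PRel := by
  obtain ⟨-, A, Ã, d, hÃ, hnot⟩ := algebrization_iff.1 h
  exact fun halg => hnot (halg A Ã d hÃ)

/-- Both no-go statements at once. [cite: AaronsonWigderson2008, §5.1] -/
theorem Algebrization.summary (h : Algebrization) :
    ¬ IsAlgebrizingSeparation NPRel PRel ∧ ¬ IsAlgebrizingInclusion NPRel PRel :=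
  ⟨h.not_isAlgebrizingSeparation_NP_P, h.not_isAlgebrizingInclusion_NP_P⟩

/-! ### Relativizing (language oracles, `Relativizes`) implies algebrizing -/

/-- An inclusion `C ⊆ D` that RELATIVIZES in the catalogue's sense (`Relativizes`, i.e. holds
relative to every language oracle `Oracle.ofLanguage A`; `Relativization.lean`) algebrizes: this
is the observation that relativizing techniques are contained in algebrizing ones
(Impagliazzo–Kabanets–Kolokolova 2009, §1, "Our results", last paragraph). The only extra
hypothesis is monotonicity of the RIGHT-HAND class from `A` to `Ã`,
`hmono : D (ofLanguage A) ⊆ D Ã.toOracle` (an oracle machine for `A` may query `Ã` at Boolean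
points; AW §1.3.2 p. 5: "an algorithm can always restrict itself to Boolean queries only").
[cite: ImpagliazzoKabanetsKolokolova2009, §1 p. 3] [cite: AaronsonWigderson2008, §1.3.2 p. 5] -/
theorem isAlgebrizingInclusion_of_relativizes {C D : Oracle → Set (Language Bool)}
    (hmono : ∀ (A : Language Bool) (Ã : ExtensionOracle) (d : ℕ), Ã.IsExtensionOf A d →
      D (Oracle.ofLanguage A) ⊆ D Ã.toOracle)
    (h : Relativizes fun O => C O ⊆ D O) : IsAlgebrizingInclusion C D :=
  fun A Ã d hÃ => (h A).trans (hmono A Ã d hÃ)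

/-- A separation `C ⊄ D` that RELATIVIZES (`Relativizes fun O => ¬ C O ⊆ D O`) algebrizes,
given that the LEFT-HAND class `C` (the one being separated from `D`, which receives `Ã` in AW
Def. 2.3) only grows when passing from `A` to `Ã` (`hmono : C^A ⊆ C^Ã`).
[cite: ImpagliazzoKabanetsKolokolova2009, §1 p. 3] [cite: AaronsonWigderson2008, Def. 2.3] -/
theorem isAlgebrizingSeparation_of_relativizes {C D : Oracle → Set (Language Bool)}
    (hmono : ∀ (A : Language Bool) (Ã : ExtensionOracle) (d : ℕ), Ã.IsExtensionOf A d →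
      C (Oracle.ofLanguage A) ⊆ C Ã.toOracle)
    (h : Relativizes fun O => ¬ C O ⊆ D O) : IsAlgebrizingSeparation C D :=
  fun A Ã d hÃ hsub => h A ((hmono A Ã d hÃ).trans hsub)

/-- Consequently the algebrization barrier contains the relativization barrier for the same
statements: from `Algebrization`, neither `O ↦ NP^O ⊆ P^O` nor `O ↦ NP^O ⊄ P^O` relativizes,
given monotonicity of `P^·` resp. `NP^·` from `A` to `Ã`. (The sibling entry proves both
conclusions from Baker–Gill–Solovay WITHOUT monotonicity hypotheses:
`Relativization.not_relativizes_peqNP_shape` / `not_relativizes_pneNP_shape`; the point here is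
the containment of technique classes.) [cite: AaronsonWigderson2008, §5.1] [cite: ImpagliazzoKabanetsKolokolova2009, §1 p. 3] -/
theorem Algebrization.not_relativizes (h : Algebrization)
    (hP : ∀ (A : Language Bool) (Ã : ExtensionOracle) (d : ℕ), Ã.IsExtensionOf A d →
      PRel (Oracle.ofLanguage A) ⊆ PRel Ã.toOracle)
    (hNP : ∀ (A : Language Bool) (Ã : ExtensionOracle) (d : ℕ), Ã.IsExtensionOf A d →
      NPRel (Oracle.ofLanguage A) ⊆ NPRel Ã.toOracle) :
    (¬ Relativizes fun O => NPRel O ⊆ PRel O) ∧ ¬ Relativizes fun O => ¬ NPRel O ⊆ PRel O :=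
  ⟨fun hrel => h.not_isAlgebrizingInclusion_NP_P (isAlgebrizingInclusion_of_relativizes hP hrel),
    fun hrel => h.not_isAlgebrizingSeparation_NP_P (isAlgebrizingSeparation_of_relativizes hNP hrel)⟩

/-! ### Circuit lower bounds for `NP` (Thm. 5.6): oracle circuits and the linear-size collapse -/

/-- The **oracle gates** of a language `A ⊆ {0,1}*`: for every arity `m`, the gate of fan-in `m`
answering the slice `A_m = A ∩ {0,1}^m` on its inputs (`Language.sliceFn A m`). Aaronson–Wigderson
Def. 2.1: an oracle is the collection of Boolean functions `A_m : {0,1}^m → {0,1}` and a device of a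
class `𝒞` "can query `A_m` for any `m` of its choice"; for circuit classes (`SIZE^A(n)`,
`P^A/poly`, Thm. 5.6) this is a circuit with `A_m`-gates. [cite: AaronsonWigderson2008, Def. 2.1 and Thm. 5.6] -/
def oracleGates (A : Language Bool) : Set GateFn :=
  {g | ∃ m : ℕ, g = ⟨m, A.sliceFn m⟩}

/-- The gate of arity `m` answering `A_m` is an oracle gate of `A`. [cite: AaronsonWigderson2008, Def. 2.1] -/
theorem sliceFn_mem_oracleGates (A : Language Bool) (m : ℕ) :
    (⟨m, A.sliceFn m⟩ : GateFn) ∈ oracleGates A :=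
  ⟨m, rfl⟩

/-- The **oracle-circuit gate cost**: a gate of fan-in `≤ 2` (all of `B₂`) costs `1`, a gate
of fan-in `k ≥ 3` — here necessarily an oracle gate — costs its fan-in `k` (Wilson-style oracle
circuits: the size of an oracle gate is its number of input wires). Charging the fan-in is what
gives `SIZE^A(s)` content: with unit cost a single oracle gate of huge fan-in, fed by constant
gates, could hard-wire a whole truth table into a universal oracle language.
[cite: AaronsonWigderson2008, Def. 2.1 and Thm. 5.6 (SIZE^A(n))] -/
def oracleGateCost (g : GateFn) : ℕ :=
  if g.1 ≤ 2 then 1 else g.1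

/-- Every gate costs at least `1`. [folklore] -/
theorem one_le_oracleGateCost (g : GateFn) : 1 ≤ oracleGateCost g := by
  unfold oracleGateCost
  split <;> omega

/-- A gate of fan-in `≤ 2` costs exactly `1`. [folklore] -/
theorem oracleGateCost_of_le {g : GateFn} (h : g.1 ≤ 2) : oracleGateCost g = 1 := by
  simp [oracleGateCost, h]

/-- The fan-in-charged size of a circuit: `Σ_g oracleGateCost g` (`Circuit.sizeWith`); it is the
number of gates for circuits over `B₂` (`sizeWith_oracleGateCost_of_isOver_B2`); a plain
definition of this file (general oracle-circuit notions may later move to a Complexity file) and charges each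
oracle gate its fan-in. [cite: AaronsonWigderson2008, Def. 2.1 and Thm. 5.6] -/
def oracleSize {ι : Type*} (C : Circuit ι) : ℕ :=
  C.sizeWith oracleGateCost

/-- Over `B₂` (fan-in `≤ 2`) the fan-in-charged size is the number of gates. [folklore] -/
theorem sizeWith_oracleGateCost_of_isOver_B2 {ι : Type*} {C : Circuit ι} (h : C.IsOver B2) :
    oracleSize C = C.size := by
  unfold oracleSize Circuit.sizeWith Circuit.size
  have : ∀ l : List (Gate ι), (∀ g ∈ l, g.fn ∈ B2) →
      (l.map fun g => oracleGateCost g.fn).sum = l.length := by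
    intro l hl
    induction l with
    | nil => simp
    | cons g l ih =>
      simp only [List.map_cons, List.sum_cons, List.length_cons]
      rw [ih fun g' hg' => hl g' (List.mem_cons_of_mem g hg'),
        oracleGateCost_of_le (hl g List.mem_cons_self), Nat.add_comm]
  exact this C.gates h

/-- The number of gates never exceeds the fan-in-charged size. [folklore] -/
theorem size_le_oracleSize {ι : Type*} (C : Circuit ι) : C.size ≤ oracleSize C := by
  unfold oracleSize Circuit.sizeWith Circuit.size
  have : ∀ l : List (Gate ι), l.length ≤ (l.map fun g => oracleGateCost g.fn).sum := by
    intro l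
    induction l with
    | nil => simp
    | cons g l ih =>
      simp only [List.map_cons, List.sum_cons, List.length_cons]
      have := one_le_oracleGateCost g.fn
      omega
  exact this C.gates

/-- **`SIZERel A s = SIZE^A(s)`**: languages decided by a family of circuits over the basis
`B₂ ∪ oracleGates A` (fan-in-`≤ 2` gates plus `A_m`-gates of any arity) of fan-in-charged size
`oracleSize ≤ s n` at input length `n` — an oracle gate of fan-in `k` costs `k` (`oracleGateCost`),
as for Wilson-style oracle circuits; over `B₂` alone this is the tree's gate count, so
`SIZE s ⊆ SIZE^A(s)` (`SIZE_subset_SIZERel`). Relativized version of the tree's `SIZE s`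
(`CircuitClasses.lean`, Arora–Barak Def. 6.5).
[cite: AaronsonWigderson2008, Def. 2.1 (𝒞^A for circuit classes) and Thm. 5.6 (SIZE^A(n))] -/
noncomputable def SIZERel (A : Language Bool) (s : ℕ → ℕ) : Set (Language Bool) :=
  {L | ∃ C : CircuitFamily, (∀ n, (C n).IsOver (B2 ∪ oracleGates A) ∧ oracleSize (C n) ≤ s n) ∧
    C.Decides L}

/-- Unrelativized circuits are oracle circuits that ignore the oracle: `SIZE s ⊆ SIZE^A(s)`
(over `B₂` the fan-in-charged size is the gate count). [cite: AaronsonWigderson2008, Def. 2.1] -/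
theorem SIZE_subset_SIZERel (A : Language Bool) (s : ℕ → ℕ) : SIZE s ⊆ SIZERel A s := by
  rintro L ⟨C, hC, hdec⟩
  refine ⟨C, fun n => ⟨fun g hg => Or.inl ((hC n).1 g hg), ?_⟩, hdec⟩
  rw [sizeWith_oracleGateCost_of_isOver_B2 (hC n).1]
  exact (hC n).2

/-- `SIZERel` is monotone in the size bound. [folklore] -/
theorem SIZERel_mono (A : Language Bool) {s s' : ℕ → ℕ} (h : ∀ n, s n ≤ s' n) :
    SIZERel A s ⊆ SIZERel A s' := by
  rintro L ⟨C, hC, hdec⟩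
  exact ⟨C, fun n => ⟨(hC n).1, ((hC n).2).trans (h n)⟩, hdec⟩

/-- The one-gate oracle circuit on `n` inputs: a single `A_n`-gate reading all inputs in order.
[cite: AaronsonWigderson2008, Def. 2.1] -/
noncomputable def oracleCircuit (A : Language Bool) (n : ℕ) : Circuit (Fin n) where
  gates := [⟨n, A.sliceFn n, fun a => .inl a⟩]
  output := .inr 0
  wf j h a m hm := by
    simp only [List.length_singleton, Nat.lt_one_iff] at h
    subst h
    simp at hm
  wf_output m h := by cases h; simp

/-- The one-gate oracle circuit outputs `[x ∈ A]`. [cite: AaronsonWigderson2008, Def. 2.1] -/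
theorem eval_oracleCircuit (A : Language Bool) (n : ℕ) (x : Fin n → Bool) :
    (oracleCircuit A n).eval x = A.sliceFn n x := rfl

/-- The one-gate oracle circuit has fan-in-charged size `≤ n + 1` (its single gate of fan-in `n`
costs `n` if `n ≥ 3`, else `1`). [cite: AaronsonWigderson2008, Def. 2.1] -/
theorem oracleSize_oracleCircuit_le (A : Language Bool) (n : ℕ) :
    oracleSize (oracleCircuit A n) ≤ n + 1 := by
  simp only [oracleSize, Circuit.sizeWith, oracleCircuit, List.map_cons, List.map_nil,
    List.sum_cons, List.sum_nil, Nat.add_zero, Gate.fn, oracleGateCost]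
  split <;> omega

/-- Adequacy / non-vacuity of the oracle-gate semantics: `A ∈ SIZE^A(n + 1)` — the language `A`
itself is decided by the family of one-gate oracle circuits, at fan-in-charged cost `≤ n + 1`
(compare `self_mem_PRel_ofLanguage`, `A ∈ P^A`). [cite: AaronsonWigderson2008, Def. 2.1] -/
theorem self_mem_SIZERel (A : Language Bool) : A ∈ SIZERel A fun n => n + 1 := by
  refine ⟨fun n => oracleCircuit A n, fun n => ⟨?_, oracleSize_oracleCircuit_le A n⟩, fun x => ?_⟩
  · intro g hg
    simp only [oracleCircuit, List.mem_singleton] at hg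
    subst hg
    exact Or.inr (sliceFn_mem_oracleGates A n)
  · change A.sliceFn x.length x.get = A.boolIndicator x
    simp [Language.sliceFn, List.ofFn_get]

/-- **Aaronson–Wigderson Thm. 5.6, linear-size corollary for `NP`.** Thm. 5.6: "There exist
`A, Ã` such that `NTIME^Ã(2ⁿ) ⊂ SIZE^A(n)`"; since `NP^Ã ⊆ NTIME^Ã(2ⁿ)`, in particular
`NP^Ã ⊆ SIZE^A(O(n))` (AW §1.2 p. 3: "there exist `A, Ã` relative to which ... `NP^Ã ⊂ SIZE^A(n)`";
"non-algebrizing techniques will be needed even ... to prove superlinear circuit lower bounds for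
NP"). Recorded as: for some oracle language `A` and some multiquadratic extension `Ã` (tree: prime
fields), every language of `NP^Ã` (tree:
`NPRel Ã.toOracle`; `Ã` multiquadratic, `IsExtensionOf A 2`, as in AW's proof) is decided by
`A`-oracle circuits of fan-in-charged size `≤ c·n + c` for a constant `c` DEPENDING ON THE LANGUAGE (`⋃ c, SIZE^A(c·n + c)`, the class of languages with
linear-size oracle circuits — as in AW's proof, where the machine `M_i` is simulated only at
lengths `n ≥ i`, p. 26). AW's circuit hardwires a string `z'`, computes `z' ⊕ w_{i,x}` and applies
one `A_{4n}`-gate: `O(n)` gates and `O(n)` wires, so linear also with the fan-in charged. IMPLIED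
BY the printed theorem, not verbatim (`NTIME^Ã(2ⁿ)` is not in the tree). Fan-in locus (barrier
audit 2026-08-17): the wide gate is essential — with `A`-gates of fan-in `≤ (p/q)·n`, `p < q`, no
pair `(A, Ã)` achieves the inclusion unless `NP` has fixed-polynomial circuits
(`Algebrization_npLinearSizeNarrow`, `AlgebrizationProofsFanIn.lean`).
[cite: AaronsonWigderson2008, Thm. 5.6 and §1.2 p. 3] -/
def Algebrization_npLinearSize : Prop :=
  ∃ (A : Language Bool) (Ã : ExtensionOracle), Ã.IsExtensionOf A 2 ∧
    NPRel Ã.toOracle ⊆ ⋃ c : ℕ, SIZERel A (fun n => c * n + c)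

/-- **"Non-algebrizing techniques will be needed ... to prove superlinear circuit lower bounds for
NP"** (AW §1.2), formally: it is not the case that for all `A`, `Ã`, some language of `NP^Ã` lacks
linear-size `A`-oracle circuits — the algebrizing-separation shape (AW Def. 2.3, `C^Ã ⊄ D^A`) of
the strengthening "`NP ⊄ SIZE(O(n))`" of `PneNP` fails. Proved from `Algebrization_npLinearSize`.
[cite: AaronsonWigderson2008, Thm. 5.6 with Def. 2.3] -/
theorem not_forall_not_NPRel_subset_SIZERel (h : Algebrization_npLinearSize) :
    ¬ ∀ (A : Language Bool) (Ã : ExtensionOracle) (d : ℕ), Ã.IsExtensionOf A d →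
      ¬ NPRel Ã.toOracle ⊆ ⋃ c : ℕ, SIZERel A (fun n => c * n + c) := by
  obtain ⟨A, Ã, hÃ, hsub⟩ := h
  exact fun hall => hall A Ã 2 hÃ hsub

/-- The same for every polynomial size bound `n ↦ n^k` with `k ≥ 1` (so for the shapes
`NP ⊄ SIZE(n^k)` and `NP ⊄ P/poly` of route PneNP/Circuit): from `Algebrization_npLinearSize`,
some `A, Ã` have `NP^Ã ⊆ ⋃ c, SIZE^A(c·n^k + c)`. [cite: AaronsonWigderson2008, Thm. 5.6 and §1.2 p. 3] -/
theorem exists_NPRel_subset_SIZERel_pow (h : Algebrization_npLinearSize) {k : ℕ} (hk : 1 ≤ k) :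
    ∃ (A : Language Bool) (Ã : ExtensionOracle), Ã.IsExtensionOf A 2 ∧
      NPRel Ã.toOracle ⊆ ⋃ c : ℕ, SIZERel A (fun n => c * n ^ k + c) := by
  obtain ⟨A, Ã, hÃ, hsub⟩ := h
  refine ⟨A, Ã, hÃ, hsub.trans (Set.iUnion_mono fun c => SIZERel_mono A fun n => ?_)⟩
  rcases Nat.eq_zero_or_pos n with rfl | hn
  · simp
  · exact Nat.add_le_add_right (Nat.mul_le_mul_left c (by simpa using Nat.pow_le_pow_right hn hk)) c

/-! ### Barrier audit 2026-08-16 (D-0021): the narrowed entry `AlgebrizationNarrow`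

Outcome of the refuter's audit of the block `Algebrization` above: the two oracle FACTS are
theorems of the tree (`Algebrization_holds`, `Algebrization_npLinearSize_holds` in
`AlgebrizationProofs.lean`, axioms `propext`/`Classical.choice`/`Quot.sound`) and are CONFIRMED;
the `technique_class`/`because` lines over-claim and are NARROWED here. What the printed theorems
quantify over is a class of STATEMENTS (AW Def. 2.3: inclusions `C^A ⊆ D^Ã` / separations
`C^Ã ⊄ D^A` holding for all `A, Ã`), not a class of proof ingredients: "no definition is given for
other types of statements, or for proofs" [AydinliogluBach2018, §1.2]; the notion is not known to
be closed under inference (AW §10.1; IKK §1; AB §1), and AW's own catalogue of algebrizing results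
(§3) is not "every known arithmetization-based result": the PCP theorem is non-algebrizing
(Drucker, reported in AW §5.4 p. 29: `A, Ã` with `NP^A ⊄ PCP^Ã`; "the PCP theorem is out of scope
of this and related work", AB §1 and Fig. 1), `MIP = NEXP` algebrizes only for polynomial-length
oracle queries (AW Thm. 3.8; with unrestricted queries `E ⊆ MIP` is independent of `ACT*`, IKK
Thm. 4.1 (3)), and Williams's `NEXP ⊄ ACC⁰` — which USES the arithmetization-based collapse
`EXP ⊆ P/poly ⇒ EXP = MA` (via Impagliazzo–Kabanets–Wigderson) together with a satisfiability
algorithm exploiting the structure of `ACC⁰` circuits — has a non-algebrizing conclusion (an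
algebraic oracle with `NEXP^Ã ⊂ ACC^Ã`, Aaronson's survey §6.4.2). The Lean statement below is the
sharper printed form of the barrier for `P` vs `NP` (AW p. 9: "not only `P^Ã = NP^Ã` and
`P^B̃ ≠ NP^B̃`, but also `NP^Ã ⊆ P^A` and `NP^B ⊄ P^B̃`"), from which both the asymmetric no-go
theorems above and their symmetric variants follow; it is proved in
`Literature/Barriers/PneNP/AlgebrizationSymmetric.lean` (`P^A ⊆ P^Ã`, `NP^A ⊆ NP^Ã` for `Ã`
extending `A`, AW §1.3.2). -/

/-- **Algebrization barrier for P versus NP — narrowed and symmetric form (barrier audit of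
`Algebrization`, 2026-08-16).** Printed content (AW p. 9 with Thms. 5.1, 5.3): there are `A` and
its multilinear extension `Ã` (multidegree `≤ 1`) with `NP^Ã ⊆ P^A ⊆ P^Ã` — so
`P^A = P^Ã = NP^Ã (= NP^A)`: the separation `NP ⊄ P` fails in this world whichever side receives
the algebraic oracle — and there are `B`, `B̃` (some multidegree bound; `2` in the tree's proof)
with `NP^B ⊄ P^B̃` and `NP^B ⊆ NP^B̃`, so also `NP^B̃ ⊄ P^B̃`. Consequences (proved below from this
statement): `Algebrization` itself (`AlgebrizationNarrow.algebrization`), hence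
`¬ IsAlgebrizingSeparation NPRel PRel` and `¬ IsAlgebrizingInclusion NPRel PRel`, and the symmetric
no-go statements `¬ ∀ A Ã d, Ã ext A → NP^Ã ⊄ P^Ã` (`AlgebrizationNarrow.not_symmetric_separation`)
and `¬ ∀ A Ã d, Ã ext A → NP^Ã ⊆ P^Ã` (`AlgebrizationNarrow.not_symmetric_inclusion`). Proved in
the tree: `Literature.Barriers.PneNP.algebrizationNarrow_holds` (`AlgebrizationSymmetric.lean`,
from `exists_symmetric_collapse` / `exists_symmetric_separation`).

BARRIER
technique_class: algebrizing, relativizing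
blocks: exactly the arguments whose CONCLUSION would hold relative to every pair `(A, Ã)` (tree: `Ã` over the prime fields, any constant multidegree bound): for `PneNP` the separation shapes `IsAlgebrizingSeparation NPRel PRel` (`NP^Ã ⊄ P^A` for all `A, Ã`; AW Def. 2.3) and its symmetric form `∀ A Ã, NP^Ã ⊄ P^Ã` (Fortnow/IKK-style "same algebraic oracle on both sides"), in print moreover the `k`-fold forms for every constant `k` (Thm. 10.2) and extensions over `k × k` matrix algebras, `k = poly(n)` (§10.2); for `¬PneNP` the inclusion shapes `IsAlgebrizingInclusion NPRel PRel` and `∀ A Ã, NP^Ã ⊆ P^Ã`; and the circuit shapes of the block `Algebrization` (`Algebrization_npLinearSize`, Thm. 5.6). In particular, on the separation side: a proof of `P ≠ NP` must use at least one premise that is FALSE in the single world `(A₀, Ã₀)` — print: `A₀` any PSPACE-complete language, `Ã₀` its multilinear extension (PSPACE-computable), where `P^{Ã₀} = NP^{Ã₀} = PSPACE`; tree: `A₀ = K(Ã₀)` the encoding oracle of `AlgebrizationCollapse.lean` [cite: AaronsonWigderson2008, Def. 2.3 and p. 9, Thm. 5.1, Thm. 5.3, Thm. 10.2, §10.2]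.
because: as for `Algebrization` (Thm. 5.1: the multilinear extension of a PSPACE-complete language is PSPACE-computable, Babai–Fortnow–Lund, so every uniform class between `P` and `PSPACE` collapses relative to `A₀` AND relative to `Ã₀`; Thm. 5.3: Baker–Gill–Solovay diagonalization plus the algebraic query lower bound Lemma 4.5), together with the remark that Boolean queries to `Ã` are answered as by `A` (§1.3.2 p. 5), which gives `P^A ⊆ P^Ã`, `NP^A ⊆ NP^Ã` and turns the asymmetric statements into the symmetric ones (`AlgebrizationSymmetric.lean`) [cite: AaronsonWigderson2008, §1.3.2 p. 5, Thm. 5.1, Thm. 5.3].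
evasions_known: for `P` vs `NP` itself none. NOT COVERED by the barrier (the audit's narrowing of `technique_class`): arithmetization, low-degree extensions and interactive proofs used as INGREDIENTS of an argument that contains one non-black-box step — (a) the PCP theorem is a non-algebrizing statement (Drucker: `A, Ã` with `NP^A ⊄ PCP^Ã`) and is outside all three formalisations of the barrier (AW, IKK, AB: "the PCP theorem is out of scope of this and related work") [cite: AaronsonWigderson2008, §5.4 p. 29] [cite: AydinliogluBach2018, §1 and Fig. 1]; (b) `MIP = NEXP` algebrizes only as `NEXP^{A[poly]} ⊆ MIP^Ã`; with unrestricted oracle queries `E ⊆ MIP` is independent of the arithmetic-checkability axioms `ACT*` ("although the proof of NEXP = MIP certainly uses algebraic interpolation, it also uses other nonblack-box arguments") [cite: AaronsonWigderson2008, Thm. 3.8] [cite: ImpagliazzoKabanetsKolokolova2009, Thm. 4.1 (3) and §5]; (c) on the circuit-lower-bound line of `Algebrization`'s `blocks` (`NEXP ⊄ P/poly`, superlinear / fixed-polynomial size lower bounds for `NP`) the algorithmic method is a published non-algebrizing AND non-naturalizing technique: Williams's `NEXP ⊄ ACC⁰` (also `NTIME(2ⁿ) ⊄ ACC⁰`)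 and Murray–Williams's `NQP ⊄ ACC⁰` combine the arithmetization-based collapse `EXP ⊆ P/poly ⇒ EXP = MA` / easy-witness lemmas, succinct (PCP-type) witnesses and the nondeterministic time hierarchy with a better-than-`2ⁿ` satisfiability algorithm for the circuit class — the structural, oracle-gate-sensitive step — into conclusions that fail relative to suitable algebraic oracles (`NEXP^Ã ⊂ ACC^Ã`): "noteworthy ... because it defeats all the known barriers (relativization, algebrization, and natural proofs)"; the engine is general — a `2ⁿ·poly(n)/n^{ω(1)}`-time CIRCUIT-SAT algorithm for unrestricted polynomial-size circuits would give `NEXP ⊄ P/poly` (Williams 2010) — and has not reached `P/poly`, `TC⁰` or `NP` [cite: Aaronson2016PvsNP, §6.4 and §6.4.2] [cite: Williams2014, Thm. 1.1] [cite: MurrayWilliams2018, Thm. 1.1] [cite: Williams2010STOC, Thm. 1.1]; (d) further ingredients false relative to oracle gates / algebraic oracles and hence outside the barrier: constant-depth circuit lower bounds by random restrictions or the Razborov–Smolensky method ("can be shown to fail relative to suitable oracle gates" — covered instead by natural proofs), Cook–Levin/PCP locality (Arora–Impagliazzo–Vazirani), `TIME(f) ≠ SPACE(f)` and `TIME(n)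 ≠ NTIME(n)`-type simulations, time–space trade-offs for SAT [cite: AaronsonWigderson2008, §9 p. 42 and §11 (2)]; (e) in print, still OPEN whether double-arithmetization (`k = 2`) already suffices for `NEXP ⊄ P/poly` or `P = RP` (not for `P ≠ NP`: Thm. 10.2) [cite: AaronsonWigderson2008, §10.1 p. 43].
scope_caveats: (1) statement-level barrier: "algebrizing techniques" are never defined for proofs (AB §1: "the very notion of an algebrizing proof is never made explicit"); closure under inference fails in AW's format — chaining `C ⊆ NP` (algebrizing) with `C ⊄ P` (algebrizing) yields only a double-algebrization statement (Prop. 10.1), and the relativizing tautology `(∃ C, C ⊆ NEXP ∧ C ⊄ P/poly) ⇒ NEXP ⊄ P/poly` "cannot be declared as algebrizing" (AB §1.2) — the closed reformulations (IKK's `ACT`, AB's affine relativization) re-derive the `P` vs `NP` no-go (AB: "`NP ⊄ P`, in fact `PSPACE ⊄ P`" and "`NP ⊂ P`, in fact `RP ⊂ SUBEXP`" have no affinely relativizing proof) but IKK's does NOT re-derive the `NEXP` vs `P/poly` one (only `NEXP^{A[poly]} ⊆ P^A/poly` for an `ACT*`-oracle, Thm. 4.10) [cite: AydinliogluBach2018,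 §1, §1.2 and Summary of Results] [cite: ImpagliazzoKabanetsKolokolova2009, Thm. 4.10 and §5] [cite: AaronsonWigderson2008, Prop. 10.1]; (2) tree = prime fields `𝔽_p` only and Boolean-query monotonicity proved for the tree's query encoding (`AlgebrizationSymmetric.lean`): the `∃`-statement is implied by print, the induced `∀`-no-go theorems are weaker than print (prime-field extension oracles only); (3) nothing quantitative below "superlinear": explicit linear lower bounds `c·n` over `B₂` (gate elimination, `c ≤ 3.1`) are untouched by this barrier and limited instead by `GateEliminationLimit.lean`; (4) AW's query-length conventions `A[poly]` (Def. 2.1) matter for `EXP`/`NEXP`-type classes, not for `P`, `NP` [cite: AaronsonWigderson2008, Def. 2.1–2.2 and footnote 5]; (5) multidegree (barrier audit of `AlgebrizationForcing.lean`, 2026-08-16): the worlds have different degrees — the collapse world (Thm. 5.1, first conjunct) is multilinear (`d = 1`), whereas the separation world (Thm. 5.3, second conjunct; `2` in the tree's proof) and the `NP`-circuit world `Algebrization_npLinearSize` (Thm. 5.6, `IsExtensionOf A 2`) are multiquadratic, and the forcing lemma behind them (AW Lemma 4.5, `Multiquadratic.exists_free`) is FALSE at multidegree `1` over every odd prime field,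 because one query to a multilinear extension at `(½, …, ½)` returns `½ⁿ · |A_m|` (section `DegreeOne` of `AlgebrizationForcing.lean`: `AW56.eval_half_of_degreeOf_le_one`, `AW56.not_exists_free_degreeOne`; AW p. 7 after Juma–Kabanets–Rackoff–Shpilka, p. 19 "multidegree 2 is essential here", p. 8 footnote 6); in print the SEPARATION side is nevertheless known with `Ã` multilinear (Thm. 5.11 (i): `NP^A ⊄ BPP^Ã` by the communication-complexity transfer, "for all of these separations `Ã` is simply the multilinear extension of `A`", p. 28), but the circuit COLLAPSE is not: "we do not know how to use communication complexity to construct `A, Ã` such that `NEXP^Ã ⊂ P^A/poly` and `NP^Ã ⊂ SIZE^A(n)`" (p. 6) — in characteristic `2` it is (Aydınlıoğlu–Bach, Thm. 35 with the `𝔽₂`-linear interpolation Lemma 33: an affine = multilinear-over-`GF(2ᵏ)` oracle with `NE^{f̃} ⊂ SIZE^f(n^d)`, so "`NEXP ⊄ P/poly`, in fact `NEXP ⊄ SIZE(n^d) ∀ d`" has no affinely relativizing proof), while over the odd prime fields of the tree's model a degree-`1` world with `NP^Ã ⊆ ⋃ c, SIZE^A(c·n + c)` is not established; consequently, for conclusions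 of the fixed-polynomial shape `NP ⊄ SIZE(n^k)` (`k` fixed; these do not imply `PneNP`, and in any world of the Thm. 5.1 kind they even hold, `PH^A = P^A ⊆ NP^Ã` with Kannan's relativizing `Σ₂^A ⊄ SIZE^A(n^k)`), arguments that are sound only relative to MULTILINEAR extensions over the prime fields are not excluded by this entry — `NP ⊄ P/poly` is (first conjunct, `d = 1`: `NP^Ã ⊆ P^A ⊆ P^A/poly`) [cite: AaronsonWigderson2008, §1.3 p. 6, §1.4 p. 7, Def. 2.2 footnote 6 (p. 8), remark after Thm. 4.4 (p. 19), Thm. 5.11 (p. 28)] [cite: AydinliogluBach2018, Summary of Results, §4.1 Lemma 33 and Thm. 35]; (6) fan-in locus of the circuit shapes (barrier audit of `AlgebrizationProofs.lean`, 2026-08-17): the `NP`-circuit collapse needs `A`-gates of fan-in `> (1-δ)·n` for every `δ > 0` unless `NP` has fixed-polynomial circuits — see `Algebrization` (iv) and the narrowed entry `Algebrization_npLinearSizeNarrow` (`AlgebrizationProofsFanIn.lean`) [cite: AaronsonWigderson2008, Thm. 5.6 (p. 26)].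
status: theorem (established): `algebrizationNarrow_holds` in `AlgebrizationSymmetric.lean` [cite: AaronsonWigderson2008, Thm. 5.1, Thm. 5.3 and p. 9] -/
def AlgebrizationNarrow : Prop :=
  (∃ (A : Language Bool) (Ã : ExtensionOracle), Ã.IsExtensionOf A 1 ∧
      NPRel Ã.toOracle ⊆ PRel (Oracle.ofLanguage A) ∧
        PRel (Oracle.ofLanguage A) ⊆ PRel Ã.toOracle) ∧
    ∃ (A : Language Bool) (Ã : ExtensionOracle) (d : ℕ), Ã.IsExtensionOf A d ∧
      ¬ NPRel (Oracle.ofLanguage A) ⊆ PRel Ã.toOracle ∧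
        NPRel (Oracle.ofLanguage A) ⊆ NPRel Ã.toOracle

/-- The narrowed statement refines the catalogued one: `AlgebrizationNarrow → Algebrization`
(forget the monotonicity conjuncts; degree bound `1` for the collapse).
[cite: AaronsonWigderson2008, Thm. 5.1, Thm. 5.3] -/
theorem AlgebrizationNarrow.algebrization (h : AlgebrizationNarrow) : Algebrization := by
  obtain ⟨⟨A, Ã, hÃ, hsub, -⟩, B, B', d, hB, hnot, -⟩ := h
  exact ⟨⟨A, Ã, 1, hÃ, hsub⟩, B, B', d, hB, hnot⟩

/-- **Symmetric collapse** (AW p. 9, "`P^Ã = NP^Ã`"): in the first world `NP^Ã ⊆ P^Ã`.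
[cite: AaronsonWigderson2008, p. 9 and Thm. 5.1] -/
theorem AlgebrizationNarrow.exists_NPRel_subset_PRel_toOracle (h : AlgebrizationNarrow) :
    ∃ (A : Language Bool) (Ã : ExtensionOracle), Ã.IsExtensionOf A 1 ∧
      NPRel Ã.toOracle ⊆ PRel Ã.toOracle := by
  obtain ⟨⟨A, Ã, hÃ, hsub, hmono⟩, -⟩ := h
  exact ⟨A, Ã, hÃ, hsub.trans hmono⟩

/-- **Symmetric separation** (AW p. 9, "`P^B̃ ≠ NP^B̃`"): in the second world `NP^B̃ ⊄ P^B̃`.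
[cite: AaronsonWigderson2008, p. 9 and Thm. 5.3] -/
theorem AlgebrizationNarrow.exists_not_NPRel_subset_PRel_toOracle (h : AlgebrizationNarrow) :
    ∃ (A : Language Bool) (Ã : ExtensionOracle) (d : ℕ), Ã.IsExtensionOf A d ∧
      ¬ NPRel Ã.toOracle ⊆ PRel Ã.toOracle := by
  obtain ⟨-, B, B', d, hB, hnot, hmono⟩ := h
  exact ⟨B, B', d, hB, fun hsub => hnot (hmono.trans hsub)⟩

/-- **No proof of `P ≠ NP` relativizes with respect to algebraic oracles given to BOTH sides**
(the symmetric reading is blocked too): `¬ ∀ A Ã d, Ã ext A → NP^Ã ⊄ P^Ã`.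
[cite: AaronsonWigderson2008, p. 9 and Thm. 5.1] -/
theorem AlgebrizationNarrow.not_symmetric_separation (h : AlgebrizationNarrow) :
    ¬ ∀ (A : Language Bool) (Ã : ExtensionOracle) (d : ℕ), Ã.IsExtensionOf A d →
      ¬ NPRel Ã.toOracle ⊆ PRel Ã.toOracle := by
  obtain ⟨A, Ã, hÃ, hsub⟩ := h.exists_NPRel_subset_PRel_toOracle
  exact fun hall => hall A Ã 1 hÃ hsub

/-- **No proof of `P = NP` relativizes with respect to algebraic oracles given to both sides**:
`¬ ∀ A Ã d, Ã ext A → NP^Ã ⊆ P^Ã`. [cite: AaronsonWigderson2008, p. 9 and Thm. 5.3] -/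
theorem AlgebrizationNarrow.not_symmetric_inclusion (h : AlgebrizationNarrow) :
    ¬ ∀ (A : Language Bool) (Ã : ExtensionOracle) (d : ℕ), Ã.IsExtensionOf A d →
      NPRel Ã.toOracle ⊆ PRel Ã.toOracle := by
  obtain ⟨A, Ã, d, hÃ, hnot⟩ := h.exists_not_NPRel_subset_PRel_toOracle
  exact fun hall => hnot (hall A Ã d hÃ)

/-- The four no-go statements for `P` vs `NP` from the narrowed barrier: asymmetric (AW Def. 2.3)
and symmetric, for the separation and for the inclusion. [cite: AaronsonWigderson2008, §5.1 and p. 9] -/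
theorem AlgebrizationNarrow.summary (h : AlgebrizationNarrow) :
    ¬ IsAlgebrizingSeparation NPRel PRel ∧ ¬ IsAlgebrizingInclusion NPRel PRel ∧
      (¬ ∀ (A : Language Bool) (Ã : ExtensionOracle) (d : ℕ), Ã.IsExtensionOf A d →
          ¬ NPRel Ã.toOracle ⊆ PRel Ã.toOracle) ∧
        ¬ ∀ (A : Language Bool) (Ã : ExtensionOracle) (d : ℕ), Ã.IsExtensionOf A d →
          NPRel Ã.toOracle ⊆ PRel Ã.toOracle :=
  ⟨h.algebrization.not_isAlgebrizingSeparation_NP_P, h.algebrization.not_isAlgebrizingInclusion_NP_P,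
    h.not_symmetric_separation, h.not_symmetric_inclusion⟩

/-- Assembling the narrowed statement from its two worlds (the shape proved in
`AlgebrizationSymmetric.lean`). [cite: AaronsonWigderson2008, p. 9] -/
theorem AlgebrizationNarrow.of_worlds
    (h₁ : ∃ (A : Language Bool) (Ã : ExtensionOracle), Ã.IsExtensionOf A 1 ∧
      NPRel Ã.toOracle ⊆ PRel (Oracle.ofLanguage A) ∧ PRel (Oracle.ofLanguage A) ⊆ PRel Ã.toOracle)
    (h₂ : ∃ (A : Language Bool) (Ã : ExtensionOracle) (d : ℕ), Ã.IsExtensionOf A d ∧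
      ¬ NPRel (Oracle.ofLanguage A) ⊆ PRel Ã.toOracle ∧
        NPRel (Oracle.ofLanguage A) ⊆ NPRel Ã.toOracle) :
    AlgebrizationNarrow :=
  ⟨h₁, h₂⟩

end Literature.Barriers.PneNP
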